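import Literature.AlgebraicGeometry.Motives.AbelianVarietySymmetricThreeBrauerRelations
import Literature.AlgebraicGeometry.Motives.AbelianVarietyDihedralIdempotentRelations
import Literature.AlgebraicGeometry.Motives.AbelianVarietyBrauerRelationInflation
import Mathlib.GroupTheory.SpecificGroups.Dihedral
import HarnessLib

/-!
# The Brauer relation lattice of the dihedral group `D_{2p}` (`p` an odd prime):
# `K(D_{2p}) = ℤ · (2C_2 + C_p − 2D_{2p} − 1)` — the `D_{2p}` row of Dokchitser–Green–Konstantinou–Morgan's table,
# "unique, up to multiplication by integers"; Bartel–Dokchitser's Example 2 for `C_p ⋊ C_2`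

Layer A1/A2 of the Hodge foundations lane (`lit-hodgefound`, row A1-20⁺ · A2, seat p03 generation 27, row g27-#5);
sequel of `Motives/AbelianVarietySymmetricThreeBrauerRelations` (g27-#4 — CONSUMED by name:
`finrank_brauerRelations_eq_one_of_card_eq_prime_mul_prime`, i.e. `rank K(G) = 1` for `|G| = pq` non-cyclic; and through
it g27-#1's `eq_smul_of_mem_of_finrank_eq_one` / `eq_span_singleton_of_finrank_eq_one` /
`mem_ker_linearCombination_indClassFun_one_iff` of `Motives/AbelianVarietyBrauerRelationLatticeRank`), of the dihedral
Kani–Rosen file `Motives/AbelianVarietyDihedralIdempotentRelations` (CONSUMED: `conj_eq_inv_of_mem_zpowers`,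
`τaτ⁻¹ = a⁻¹` on `⟨σ⟩`; its `isIsogenous_dihedral_odd` — `X × B_G² ∼ B_σ × B_τ²` for `|σ|` odd — IS the Kani–Rosen
isogeny of the relation treated here and is not restated), of `Motives/AbelianVarietyBrauerRelationInflation`
(`card_conj_mem_eq_card_of_mem_normal`, `card_conj_mem_eq_zero_of_not_mem_normal`: marks of a normal subgroup) and of
the marks dictionary of `Motives/AbelianVarietyBrauerRelationIsogenies` / `…InducedBrauerRelations` /
`…BrauerRelationLatticeRank` (`card_conj_mem_bot`, `card_conj_mem_one_eq`, `indClassFun_one_apply_eq_div`,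
`indClassFun_top_one`, `card_conj_mem_eq_of_zpowers_conj_eq`, `zpowers_map_mulAut_conj`).  g27-#4 did the `S_3` row
of the table on the concrete `Perm(Fin 3)` by `decide`; this file does the `D_{2p}` row for EVERY odd prime `p`, for
the dihedral group given — as in the tree's other dihedral files — BY PRESENTATION inside an arbitrary finite group
(`σ` of order `p`, `τ` of order `2`, `τστ⁻¹ = σ⁻¹`, `|G| = 2p`), and then (§5) for Mathlib's model `DihedralGroup p`
(`σ = r 1`, `τ = sr 0`).  Everything here is PROVED; NO definition, NO named fact (net Literature debt 0); no abelian
variety in the statements.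

## Sources, verbatim

V. Dokchitser, H. Green, A. Konstantinou, A. Morgan, *Parity of ranks of Jacobians of curves* (Proc. LMS 2025;
arXiv 2211.06357, held `paper:arxiv-2211.06357`, p0004), §1.3 Remark 1.5, the table `G | Θ | p | τ_{Θ,p}`:
"`C_2 × C_2` : `C_2^a + C_2^b + C_2^c − 2C_2×C_2 − {1}` … `S_3` : `2C_2 + C_3 − 2S_3 − {1}` … `D_{2p}` :
`2C_2 + C_p − 2D_{2p} − {1}` …  The above Brauer relations are unique, up to multiplication by integers."  (§1.3:
"a Brauer relation in a finite group `G` is a formal linear combination of subgroups (up to conjugacy)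
`Σ_i H_i − Σ_j H_j'`, such that the associated permutation representations `⊕_i ℂ[G/H_i]` and `⊕_j ℂ[G/H_j']` are
isomorphic.")

A. Bartel, T. Dokchitser, *Brauer relations in finite groups*, J. Eur. Math. Soc. **17** (2015) (arXiv 1103.2047, held
`paper:arxiv-1103.2047`), §2 p0006: "the rank of the kernel `K(G)` is the number of conjugacy classes of non-cyclic
subgroups. […] **Example 2.** Let `G = C_l ⋊ H`, with `l` prime and `H ≠ {1}` acting faithfully on `C` (so `H` is
cyclic of order dividing `l − 1`). Let `H̃` be any subgroup of `H`, set `G̃ = C_l ⋊ H̃`. Then,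
`H̃ − [H:H̃]·H − G̃ + [H:H̃]·G` is a relation. This can be checked by a direct computation, using the explicit
description of irreducible characters of `G` in Remark (rmrk:charSemiDir). (See e.g. Proposition (prop:relmodC).)"
(labels as in the held arXiv text).  For `l = p`, `H = C_2` acting by inversion, `H̃ = 1`:
`1 − 2C_2 − C_p + 2D_{2p} = −Θ`.

## Dictionary and what is proved (namespace `Literature.AlgebraicGeometry.Motives.AbelianVariety`)

Hypotheses (each theorem takes what it needs): `hσ : orderOf σ = p`, `hτ : orderOf τ = 2`,
`hστ : τ * σ * τ⁻¹ = σ⁻¹`, `hcard : Nat.card G = 2 * p`, `hp : p.Prime`, `hp2 : p ≠ 2` (or `Odd p`).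
`C_p = zpowers σ` (the rotations), `C_2 = zpowers τ`; reflections are the `aτ`, `a ∈ ⟨σ⟩`; marks
`m_H(g) = Nat.card {x // x⁻¹ * g * x ∈ H}`, `(1_H)^G = indClassFun H 1 = m_H/|H|`; the representatives of the four
conjugacy classes of subgroups are `![⊥, zpowers τ, zpowers σ, ⊤] : Fin 4 → Subgroup G`, `Θ = ![−1, 2, 1, −2]`
(literals repeated, no definition); the relation lattice is any `𝒦 : Submodule ℤ (Fin 4 → ℤ)` with the membership
test `h𝒦 : a ∈ 𝒦 ↔ Σ_i a_i (1_{H_i})^G = 0`, canonically the kernel of `Fintype.linearCombination`.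

* §1 `index_zpowers_eq_two_of_card`, `normal_zpowers_of_card` (`⟨σ⟩ ⊴ G`), `not_mem_zpowers_of_odd` (`τ ∉ ⟨σ⟩`),
  **`mem_zpowers_or_exists_eq_mul_of_card`** (`G = ⟨σ⟩ ⊔ ⟨σ⟩τ`), `reflection_mul_self_eq_one`,
  `orderOf_reflection_eq_two`, `conj_tau_eq_mul_self_mul` (`bτb⁻¹ = b²τ`), **`exists_conj_tau_eq_reflection`** (all
  reflections are conjugate, by square roots in the odd-order `⟨σ⟩`), `not_isCyclic_of_dihedralPrime`,
  `zpowers_eq_zpowers_of_mem` (`⟨g⟩ = ⟨σ⟩` for a rotation `g ≠ 1`).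
* §2 **`card_conj_mem_zpowers_sigma`** (`m_{C_p}(g) = 2p·[g ∈ ⟨σ⟩]`), **`card_conj_mem_zpowers_tau_of_mem`**
  (`m_{C_2} = 0` on rotations `≠ 1`), **`conj_tau_mem_zpowers_iff`** (`x⁻¹τx ∈ ⟨τ⟩ ⟺ x ∈ {1, τ}`: the centralizer of
  `τ`), **`card_conj_mem_zpowers_tau_self`** / **`card_conj_mem_zpowers_tau_reflection`** (`m_{C_2} = 2` on
  reflections).
* §3 **`two_smul_indClassFun_tau_add_indClassFun_sigma`** (`2(1_{C_2})^G + (1_{C_p})^G = (1_1)^G + 2(1_G)^G`),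
  `sum_theta_smul_indClassFun_dihedralPrime_eq_zero`.
* §4 `natCard_repr_dihedralPrime`, **`repr_dihedralPrime_nonconj`**, **`repr_dihedralPrime_covers`**,
  **`finrank_brauerRelations_dihedralPrime`** (`rank K(D_{2p}) = 1`), `theta_mem_brauerRelations_dihedralPrime`,
  **`eq_smul_theta_of_mem_brauerRelations_dihedralPrime`** (every relation is `a_{C_p}·Θ`),
  **`brauerRelations_dihedralPrime_eq_span`** (`K(D_{2p}) = ℤ·Θ`), `ker_linearCombination_indClassFun_one_dihedralPrime_eq_span`.
* §5 (Mathlib's `DihedralGroup p`, `[NeZero p]`) `dihedralGroup_sr_conj_r`, **`two_smul_indClassFun_sr_add_indClassFun_r`**,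
  **`brauerRelations_dihedralGroup_eq_span`**, `ker_linearCombination_indClassFun_one_dihedralGroup_eq_span`.

Scope (stated, not hidden).  (1) "Unique up to multiplication by integers" is formalized as `K = ℤ·Θ` for the lattice
of integer vectors on the four class representatives whose permutation characters cancel (Bartel–Dokchitser's
`K(G) = ker(B(G) → characters)`); that `![1, C_2, C_p, D_{2p}]` IS a system of representatives of the conjugacy classes
of subgroups is `repr_dihedralPrime_nonconj` + `repr_dihedralPrime_covers` + §1 of g27-#4 (every proper subgroup of a
group of order `2p` is cyclic).  (2) Bartel–Dokchitser's Example 2 is vendored only in its case `l = p`, `H = C_2`,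
`H̃ = 1` (the general `C_l ⋊ H` needs the character table of the Frobenius group `C_l ⋊ C_n`, not in the tree —
TODO(general form): `C_l ⋊ C_n`, `H̃ ≤ C_n`).  (3) The source's route through irreducible characters is replaced by
evaluating the permutation characters on `1`, rotations and reflections (§3).  (4) No abelian-variety statement is
added: the Kani–Rosen isogeny of `Θ` is `isIsogenous_dihedral_odd` (op. cit.), and by
`eq_smul_theta_of_mem_brauerRelations_dihedralPrime` every Brauer relation of a `D_{2p}`-action is a multiple of `Θ`.

## References

* [DokchitserEtAl2022] V. Dokchitser, H. Green, A. Konstantinou, A. Morgan, *Parity of ranks of Jacobians of curves*,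
  Proc. London Math. Soc. (2025), arXiv:2211.06357, §1.3 Thm. 1.3, Example 1.4, Remark 1.5.
* [BartelDokchitser2015] A. Bartel, T. Dokchitser, *Brauer relations in finite groups*, JEMS 17 (2015), §§1.1, 2 (Example 2).
* [KaniRosen1989] E. Kani, M. Rosen, *Idempotent relations and factors of Jacobians*, Math. Ann. 284 (1989), Thm. 3.
-/

noncomputable section

universe u

open CategoryTheory CategoryTheory.Limits
open Literature.RepresentationTheory.FiniteGroups

namespace Literature.AlgebraicGeometry.Motives

namespace AbelianVariety

/-! ## §1 The dihedral group of order `2p` by presentation: `σ` of odd prime order `p`, an involution `τ` with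
`τστ⁻¹ = σ⁻¹`, `|G| = 2p` -/

section DihedralPrimeGroup

variable {G : Type} [Group G] {σ τ : G} {p : ℕ}

/-- `[G : ⟨σ⟩] = 2`. [cite: DokchitserEtAl2022, §1.3 Remark 1.5 (D_{2p})] -/
theorem index_zpowers_eq_two_of_card [Finite G] (hσ : orderOf σ = p) (hp : p ≠ 0) (hcard : Nat.card G = 2 * p) :
    (Subgroup.zpowers σ).index = 2 := by
  have h := (Subgroup.zpowers σ).index_mul_card
  rw [Nat.card_zpowers, hσ, hcard] at h
  exact Nat.eq_of_mul_eq_mul_right (Nat.pos_of_ne_zero hp) h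

/-- `⟨σ⟩ ⊴ G` (index `2`). [cite: DokchitserEtAl2022, §1.3 Remark 1.5 (D_{2p})] -/
theorem normal_zpowers_of_card [Finite G] (hσ : orderOf σ = p) (hp : p ≠ 0) (hcard : Nat.card G = 2 * p) :
    (Subgroup.zpowers σ).Normal :=
  Subgroup.normal_of_index_eq_two (index_zpowers_eq_two_of_card hσ hp hcard)

/-- `τ ∉ ⟨σ⟩` (`2 ∤ p`). [cite: DokchitserEtAl2022, §1.3 Remark 1.5 (D_{2p})] -/
theorem not_mem_zpowers_of_odd (hσ : orderOf σ = p) (hp : Odd p) (hτ : orderOf τ = 2) : τ ∉ Subgroup.zpowers σ :=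
  fun h ↦ by
    have hd := orderOf_dvd_of_mem_zpowers h
    rw [hτ, hσ] at hd
    exact hp.not_two_dvd_nat hd

/-- An element of `⟨σ⟩` (`|σ| = p` odd) squaring to `1` is `1`. [folklore] -/
private theorem eq_one_of_mem_zpowers_of_mul_self (hσ : orderOf σ = p) (hp : Odd p) {a : G}
    (ha : a ∈ Subgroup.zpowers σ) (h2 : a * a = 1) : a = 1 := by
  have h1 : orderOf a ∣ p := hσ ▸ orderOf_dvd_of_mem_zpowers ha
  have h2' : orderOf a ∣ 2 := orderOf_dvd_of_pow_eq_one (by rw [pow_two, h2])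
  have : orderOf a ∣ Nat.gcd p 2 := Nat.dvd_gcd h1 h2'
  rw [(Nat.coprime_two_right.2 hp).gcd_eq_one, Nat.dvd_one] at this
  exact orderOf_eq_one_iff.1 this

/-- **`G = ⟨σ⟩ ⊔ ⟨σ⟩τ`**: every element is a rotation `a ∈ ⟨σ⟩` or a reflection `aτ`. [cite: DokchitserEtAl2022, §1.3 Remark 1.5 (D_{2p})] -/
theorem mem_zpowers_or_exists_eq_mul_of_card [Finite G] (hσ : orderOf σ = p) (hp : Odd p) (hτ : orderOf τ = 2)
    (hcard : Nat.card G = 2 * p) (g : G) :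
    g ∈ Subgroup.zpowers σ ∨ ∃ a ∈ Subgroup.zpowers σ, g = a * τ := by
  by_cases hg : g ∈ Subgroup.zpowers σ
  · exact Or.inl hg
  refine Or.inr ⟨g * τ, ?_, ?_⟩
  · exact (Subgroup.mul_mem_iff_of_index_two (index_zpowers_eq_two_of_card hσ hp.pos.ne' hcard)).2
      (iff_of_false hg (not_mem_zpowers_of_odd hσ hp hτ))
  · rw [mul_assoc, ← pow_two, ← hτ, pow_orderOf_eq_one, mul_one]

/-- `τ² = 1`, as `τ⁻¹ = τ`. [folklore] -/
private theorem inv_eq_self_of_orderOf_eq_two (hτ : orderOf τ = 2) : τ⁻¹ = τ :=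
  inv_eq_of_mul_eq_one_right (by rw [← pow_two, ← hτ, pow_orderOf_eq_one])

/-- **Reflections are involutions**: `(aτ)² = 1` for `a ∈ ⟨σ⟩` (`τaτ⁻¹ = a⁻¹`). [cite: DokchitserEtAl2022, §1.3 Remark 1.5 (D_{2p})] -/
theorem reflection_mul_self_eq_one (hτ : orderOf τ = 2) (hστ : τ * σ * τ⁻¹ = σ⁻¹) {a : G}
    (ha : a ∈ Subgroup.zpowers σ) : a * τ * (a * τ) = 1 := by
  have h := conj_eq_inv_of_mem_zpowers hστ a ha
  calc a * τ * (a * τ) = a * (τ * a * τ⁻¹) * (τ * τ) := by group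
    _ = 1 := by rw [h, mul_inv_cancel, one_mul, ← pow_two, ← hτ, pow_orderOf_eq_one]

/-- `aτ ∉ ⟨σ⟩`. [folklore] -/
private theorem reflection_not_mem (hσ : orderOf σ = p) (hp : Odd p) (hτ : orderOf τ = 2) {a : G}
    (ha : a ∈ Subgroup.zpowers σ) : a * τ ∉ Subgroup.zpowers σ := fun h ↦
  not_mem_zpowers_of_odd hσ hp hτ (by simpa only [inv_mul_cancel_left] using Subgroup.mul_mem _ (Subgroup.inv_mem _ ha) h)

/-- `|aτ| = 2`. [cite: DokchitserEtAl2022, §1.3 Remark 1.5 (D_{2p}: the class C_2)] -/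
theorem orderOf_reflection_eq_two (hσ : orderOf σ = p) (hp : Odd p) (hτ : orderOf τ = 2) (hστ : τ * σ * τ⁻¹ = σ⁻¹)
    {a : G} (ha : a ∈ Subgroup.zpowers σ) : orderOf (a * τ) = 2 :=
  haveI : Fact (Nat.Prime 2) := Nat.fact_prime_two
  orderOf_eq_prime (by rw [pow_two]; exact reflection_mul_self_eq_one hτ hστ ha) fun h1 ↦
    reflection_not_mem hσ hp hτ ha (h1 ▸ Subgroup.one_mem _)

/-- **Square roots in `⟨σ⟩`** (odd order: squaring is a bijection). [folklore] -/
private theorem exists_mul_self_eq (hσ : orderOf σ = p) (hp : Odd p) {a : G} (ha : a ∈ Subgroup.zpowers σ) :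
    ∃ b ∈ Subgroup.zpowers σ, b * b = a := by
  have hcop : (Nat.card (Subgroup.zpowers σ)).Coprime 2 := by
    rw [Nat.card_zpowers, hσ]
    exact Nat.coprime_two_right.2 hp
  obtain ⟨b, hb⟩ := (powCoprime hcop).surjective ⟨a, ha⟩
  refine ⟨b, b.2, ?_⟩
  have h := congrArg Subtype.val hb
  rwa [powCoprime_apply, Subgroup.coe_pow, pow_two] at h

/-- **All reflections are conjugate** (`p` odd): `bτb⁻¹ = b²τ` for `b ∈ ⟨σ⟩`. [cite: DokchitserEtAl2022, §1.3 Remark 1.5 (D_{2p}: one class C_2)] -/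
theorem conj_tau_eq_mul_self_mul (hστ : τ * σ * τ⁻¹ = σ⁻¹) {b : G} (hb : b ∈ Subgroup.zpowers σ) :
    b * τ * b⁻¹ = b * b * τ := by
  have h := conj_eq_inv_of_mem_zpowers hστ b⁻¹ (Subgroup.inv_mem _ hb)
  rw [inv_inv] at h
  calc b * τ * b⁻¹ = b * (τ * b⁻¹ * τ⁻¹) * τ := by group
    _ = b * b * τ := by rw [h]

/-- Every reflection `aτ` is `bτb⁻¹` with `b ∈ ⟨σ⟩`, `b² = a`. [cite: DokchitserEtAl2022, §1.3 Remark 1.5 (D_{2p}: one class C_2)] -/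
theorem exists_conj_tau_eq_reflection (hσ : orderOf σ = p) (hp : Odd p) (hστ : τ * σ * τ⁻¹ = σ⁻¹) {a : G}
    (ha : a ∈ Subgroup.zpowers σ) : ∃ b ∈ Subgroup.zpowers σ, b * τ * b⁻¹ = a * τ := by
  obtain ⟨b, hb, hbb⟩ := exists_mul_self_eq hσ hp ha
  exact ⟨b, hb, by rw [conj_tau_eq_mul_self_mul hστ hb, hbb]⟩

/-- `G` is not cyclic (`στ ≠ τσ` as `σ² ≠ 1`). [cite: DokchitserEtAl2022, §1.3 Remark 1.5 (D_{2p})] -/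
theorem not_isCyclic_of_dihedralPrime (hσ : orderOf σ = p) (hp : Odd p) (hp1 : p ≠ 1) (hστ : τ * σ * τ⁻¹ = σ⁻¹) :
    ¬ IsCyclic G := fun hc ↦ by
  have hcomm : τ * σ = σ * τ := IsCyclic.commGroup.mul_comm τ σ
  have h1 : σ = σ⁻¹ := by rw [← hστ, hcomm, mul_inv_cancel_right]
  have h2 : σ * σ = 1 := by
    nth_rewrite 2 [h1]
    exact mul_inv_cancel σ
  have := eq_one_of_mem_zpowers_of_mul_self hσ hp (Subgroup.mem_zpowers σ) h2
  rw [this, orderOf_one] at hσ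
  exact hp1 hσ.symm

/-- `⟨g⟩ = ⟨σ⟩` for a rotation `g ≠ 1` (`|σ| = p` prime). [cite: DokchitserEtAl2022, §1.3 Remark 1.5 (D_{2p}: the class C_p)] -/
theorem zpowers_eq_zpowers_of_mem (hσ : orderOf σ = p) (hp : p.Prime) {g : G} (hg : g ∈ Subgroup.zpowers σ)
    (hg1 : g ≠ 1) : Subgroup.zpowers g = Subgroup.zpowers σ := by
  have hfin : Finite (Subgroup.zpowers σ) := Nat.finite_of_card_ne_zero (by rw [Nat.card_zpowers, hσ]; exact hp.ne_zero)
  refine Subgroup.eq_of_le_of_card_ge ((Subgroup.zpowers_le).2 hg) ?_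
  rw [Nat.card_zpowers, Nat.card_zpowers, hσ]
  have hd : orderOf g ∣ p := hσ ▸ orderOf_dvd_of_mem_zpowers hg
  rcases (Nat.dvd_prime hp).1 hd with h | h
  · exact absurd (orderOf_eq_one_iff.1 h) hg1
  · rw [h]

end DihedralPrimeGroup

/-! ## §2 The marks of `C_p = ⟨σ⟩` and `C_2 = ⟨τ⟩` -/

section DihedralPrimeMarks

variable {G : Type} [Group G] {σ τ : G} {p : ℕ}

/-- **`m_{C_p}(g) = 2p · [g ∈ ⟨σ⟩]`** (`⟨σ⟩` is normal). [cite: DokchitserEtAl2022, §1.3 Remark 1.5 (D_{2p})] [cite: BartelDokchitser2015, §2 Example 2 (H̃ = 1)] -/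
theorem card_conj_mem_zpowers_sigma [Finite G] (hσ : orderOf σ = p) (hp : p ≠ 0) (hcard : Nat.card G = 2 * p)
    (g : G) : Nat.card {x : G // x⁻¹ * g * x ∈ Subgroup.zpowers σ} = if g ∈ Subgroup.zpowers σ then 2 * p else 0 := by
  classical
  haveI := normal_zpowers_of_card hσ hp hcard
  split_ifs with hg
  · rw [card_conj_mem_eq_card_of_mem_normal _ hg, hcard]
  · exact card_conj_mem_eq_zero_of_not_mem_normal _ hg

/-- `y ∈ ⟨τ⟩`, `|τ| = 2` ⟹ `y = 1 ∨ y = τ`. [folklore] -/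
private theorem eq_one_or_eq_of_mem_zpowers [Finite G] (hτ : orderOf τ = 2) {y : G} (hy : y ∈ Subgroup.zpowers τ) :
    y = 1 ∨ y = τ := by
  classical
  rw [mem_zpowers_iff_mem_range_orderOf, hτ, Finset.mem_image] at hy
  obtain ⟨k, hk, rfl⟩ := hy
  rw [Finset.mem_range] at hk
  interval_cases k
  · exact Or.inl (pow_zero τ)
  · exact Or.inr (pow_one τ)

/-- **`m_{C_2}(g) = 0` on rotations `g ≠ 1`** (a conjugate of `g` lies in `⟨σ⟩ ∩ ⟨τ⟩ = 1` only if `g = 1`).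
[cite: DokchitserEtAl2022, §1.3 Remark 1.5 (D_{2p})] -/
theorem card_conj_mem_zpowers_tau_of_mem [Finite G] (hσ : orderOf σ = p) (hp : Odd p) (hτ : orderOf τ = 2)
    (hcard : Nat.card G = 2 * p) {g : G} (hg : g ∈ Subgroup.zpowers σ) (hg1 : g ≠ 1) :
    Nat.card {x : G // x⁻¹ * g * x ∈ Subgroup.zpowers τ} = 0 := by
  haveI := normal_zpowers_of_card hσ hp.pos.ne' hcard
  rw [Nat.card_eq_zero]
  refine Or.inl ⟨fun x ↦ hg1 ?_⟩
  have hA : x.1⁻¹ * g * x.1 ∈ Subgroup.zpowers σ := ‹(Subgroup.zpowers σ).Normal›.conj_mem' g hg x.1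
  have h2 : x.1⁻¹ * g * x.1 * (x.1⁻¹ * g * x.1) = 1 := by
    rcases eq_one_or_eq_of_mem_zpowers hτ x.2 with h | h
    · rw [h, mul_one]
    · rw [h, ← pow_two, ← hτ, pow_orderOf_eq_one]
  have h1 := eq_one_of_mem_zpowers_of_mul_self hσ hp hA h2
  calc g = x.1 * (x.1⁻¹ * g * x.1) * x.1⁻¹ := by group
    _ = 1 := by rw [h1, mul_one, mul_inv_cancel]

/-- **The centralizer of `τ` is `{1, τ}`**: `x⁻¹τx ∈ ⟨τ⟩ ⟺ x = 1 ∨ x = τ`. [cite: DokchitserEtAl2022, §1.3 Remark 1.5 (D_{2p})] -/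
theorem conj_tau_mem_zpowers_iff [Finite G] (hσ : orderOf σ = p) (hp : Odd p) (hτ : orderOf τ = 2)
    (hστ : τ * σ * τ⁻¹ = σ⁻¹) (hcard : Nat.card G = 2 * p) (x : G) :
    x⁻¹ * τ * x ∈ Subgroup.zpowers τ ↔ x = 1 ∨ x = τ := by
  have hτi := inv_eq_self_of_orderOf_eq_two hτ
  constructor
  · intro hx
    -- `x⁻¹τx` is an involution in `⟨τ⟩`, hence `= τ`: `x` commutes with `τ`
    have hxτ : x⁻¹ * τ * x = τ := by
      rcases eq_one_or_eq_of_mem_zpowers hτ hx with h | h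
      · exfalso
        have h1 : τ = 1 := by
          calc τ = x * (x⁻¹ * τ * x) * x⁻¹ := by group
            _ = 1 := by rw [h, mul_one, mul_inv_cancel]
        rw [h1, orderOf_one] at hτ
        exact absurd hτ (by decide)
      · exact h
    have hcomm : τ * x = x * τ := by
      calc τ * x = x * (x⁻¹ * τ * x) := by group
        _ = x * τ := by rw [hxτ]
    rcases mem_zpowers_or_exists_eq_mul_of_card hσ hp hτ hcard x with ha | ⟨a, ha, rfl⟩
    · -- a rotation commuting with `τ`: `a = τaτ⁻¹ = a⁻¹`
      left
      have h := conj_eq_inv_of_mem_zpowers hστ x ha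
      rw [hcomm, mul_inv_cancel_right] at h
      exact eq_one_of_mem_zpowers_of_mul_self hσ hp ha (by nth_rewrite 2 [h]; exact mul_inv_cancel x)
    · -- a reflection `aτ` commuting with `τ`: again `a = a⁻¹`
      right
      have h := conj_eq_inv_of_mem_zpowers hστ a ha
      have e1 : τ * a * τ = a := by
        rw [mul_assoc τ a τ, hcomm, mul_assoc, ← pow_two, ← hτ, pow_orderOf_eq_one, mul_one]
      have h' : a = a⁻¹ := by rw [← h, hτi, e1]
      have ha1 := eq_one_of_mem_zpowers_of_mul_self hσ hp ha (by nth_rewrite 2 [h']; exact mul_inv_cancel a)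
      rw [ha1, one_mul]
  · rintro (rfl | rfl)
    · rw [inv_one, one_mul, mul_one]; exact Subgroup.mem_zpowers _
    · rw [inv_mul_cancel, one_mul]; exact Subgroup.mem_zpowers _

/-- **`m_{C_2}(τ) = 2`.** [cite: DokchitserEtAl2022, §1.3 Remark 1.5 (D_{2p})] -/
theorem card_conj_mem_zpowers_tau_self [Finite G] (hσ : orderOf σ = p) (hp : Odd p) (hτ : orderOf τ = 2)
    (hστ : τ * σ * τ⁻¹ = σ⁻¹) (hcard : Nat.card G = 2 * p) :
    Nat.card {x : G // x⁻¹ * τ * x ∈ Subgroup.zpowers τ} = 2 := by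
  classical
  have hτ1 : (1 : G) ≠ τ := fun h ↦ by rw [← h, orderOf_one] at hτ; exact absurd hτ (by decide)
  rw [Nat.card_congr (Equiv.subtypeEquivRight fun x ↦ (conj_tau_mem_zpowers_iff hσ hp hτ hστ hcard x).trans
      (by rw [Finset.mem_insert, Finset.mem_singleton] :
        x = 1 ∨ x = τ ↔ x ∈ ({1, τ} : Finset G))),
    Nat.card_eq_fintype_card, Fintype.card_coe, Finset.card_pair hτ1]

/-- **`m_{C_2}(aτ) = 2` for every reflection** (all reflections are conjugate to `τ`).
[cite: DokchitserEtAl2022, §1.3 Remark 1.5 (D_{2p})] -/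
theorem card_conj_mem_zpowers_tau_reflection [Finite G] (hσ : orderOf σ = p) (hp : Odd p) (hτ : orderOf τ = 2)
    (hστ : τ * σ * τ⁻¹ = σ⁻¹) (hcard : Nat.card G = 2 * p) {a : G} (ha : a ∈ Subgroup.zpowers σ) :
    Nat.card {x : G // x⁻¹ * (a * τ) * x ∈ Subgroup.zpowers τ} = 2 := by
  obtain ⟨b, -, hb⟩ := exists_conj_tau_eq_reflection hσ hp hστ ha
  rw [card_conj_mem_eq_of_zpowers_conj_eq (Subgroup.zpowers τ) (g := a * τ) (h := τ) (x := b⁻¹)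
      (by rw [← hb]; congr 1; group),
    card_conj_mem_zpowers_tau_self hσ hp hτ hστ hcard]

end DihedralPrimeMarks

/-! ## §3 The Brauer relation `Θ = 2C_2 + C_p − 2D_{2p} − 1` as an identity of permutation characters -/

section DihedralPrimeRelation

variable {G : Type} [Group G] [Fintype G] {σ τ : G} {p : ℕ}

/-- **`2·(1_{C_2})^G + (1_{C_p})^G = (1_1)^G + 2·(1_G)^G` for `G = D_{2p}`, `p` an odd prime** ("`D_{2p}`:
`2C_2 + C_p − 2D_{2p} − {1}`"; Bartel–Dokchitser's `H̃ − [H:H̃]·H − G̃ + [H:H̃]·G` with `G = C_p ⋊ C_2`, `H̃ = 1`),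
checked on rotations and reflections: at `1`: `2p + 2 = 2p + 2`; at a rotation `≠ 1`: `0 + 2 = 0 + 2`; at a
reflection: `2 + 0 = 0 + 2`. [cite: DokchitserEtAl2022, §1.3 Remark 1.5] [cite: BartelDokchitser2015, §2 Example 2] -/
theorem two_smul_indClassFun_tau_add_indClassFun_sigma (hσ : orderOf σ = p) (hp : p.Prime) (hp2 : p ≠ 2)
    (hτ : orderOf τ = 2) (hστ : τ * σ * τ⁻¹ = σ⁻¹) (hcard : Nat.card G = 2 * p) :
    (2 : ℂ) • indClassFun (Subgroup.zpowers τ) 1 + indClassFun (Subgroup.zpowers σ) 1 =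
      indClassFun (⊥ : Subgroup G) 1 + (2 : ℂ) • indClassFun (⊤ : Subgroup G) 1 := by
  classical
  have hodd : Odd p := hp.eq_two_or_odd'.resolve_left hp2
  have hp0 : (p : ℂ) ≠ 0 := Nat.cast_ne_zero.2 hp.ne_zero
  have hcardF : Fintype.card G = 2 * p := by rw [← Nat.card_eq_fintype_card, hcard]
  funext g
  simp only [Pi.add_apply, Pi.smul_apply, smul_eq_mul]
  rw [indClassFun_one_apply_eq_div, indClassFun_one_apply_eq_div, indClassFun_one_apply_eq_div (⊥ : Subgroup G),
    indClassFun_top_one, Pi.one_apply, card_conj_mem_bot, card_conj_mem_zpowers_sigma hσ hp.ne_zero hcard,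
    Nat.card_zpowers, Nat.card_zpowers, hσ, hτ, Subgroup.card_bot, hcardF]
  rcases mem_zpowers_or_exists_eq_mul_of_card hσ hodd hτ hcard g with hg | ⟨a, ha, rfl⟩
  · by_cases hg1 : g = 1
    · subst hg1
      rw [card_conj_mem_one_eq, hcardF, if_pos (Subgroup.one_mem _), if_pos rfl]
      push_cast
      field_simp
    · rw [card_conj_mem_zpowers_tau_of_mem hσ hodd hτ hcard hg hg1, if_pos hg, if_neg hg1]
      push_cast
      field_simp
  · have h1 : a * τ ≠ 1 := fun h ↦ reflection_not_mem hσ hodd hτ ha (h ▸ Subgroup.one_mem _)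
    rw [card_conj_mem_zpowers_tau_reflection hσ hodd hτ hστ hcard ha, if_neg (reflection_not_mem hσ hodd hτ ha),
      if_neg h1]
    push_cast
    field_simp
    ring

/-- The same as a vanishing signed combination over the representatives `![1, C_2, C_p, D_{2p}]` with coefficients
`Θ = ![−1, 2, 1, −2]`. [cite: DokchitserEtAl2022, §1.3 Remark 1.5] -/
theorem sum_theta_smul_indClassFun_dihedralPrime_eq_zero (hσ : orderOf σ = p) (hp : p.Prime) (hp2 : p ≠ 2)
    (hτ : orderOf τ = 2) (hστ : τ * σ * τ⁻¹ = σ⁻¹) (hcard : Nat.card G = 2 * p) :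
    ∑ i : Fin 4, ((![-1, 2, 1, -2] : Fin 4 → ℤ) i : ℂ) •
      indClassFun ((![⊥, Subgroup.zpowers τ, Subgroup.zpowers σ, ⊤] : Fin 4 → Subgroup G) i) 1 = 0 := by
  rw [Fin.sum_univ_four]
  show ((-1 : ℤ) : ℂ) • indClassFun (⊥ : Subgroup G) 1 + ((2 : ℤ) : ℂ) • indClassFun (Subgroup.zpowers τ) 1 +
      ((1 : ℤ) : ℂ) • indClassFun (Subgroup.zpowers σ) 1 + ((-2 : ℤ) : ℂ) • indClassFun (⊤ : Subgroup G) 1 = 0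
  funext g
  have hg := congr_fun (two_smul_indClassFun_tau_add_indClassFun_sigma hσ hp hp2 hτ hστ hcard) g
  simp only [Pi.add_apply, Pi.smul_apply, smul_eq_mul, Pi.zero_apply] at hg ⊢
  push_cast
  linear_combination hg

end DihedralPrimeRelation

/-! ## §4 `K(D_{2p}) = ℤ · Θ`: "The above Brauer relations are unique, up to multiplication by integers" -/

section DihedralPrimeLattice

variable {G : Type} [Group G] [Fintype G] {σ τ : G} {p : ℕ}

omit [Fintype G] in
/-- The orders `1, 2, p, 2p` of the representatives `1, C_2 = ⟨τ⟩, C_p = ⟨σ⟩, D_{2p}`. [cite: DokchitserEtAl2022, §1.3 Remark 1.5] -/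
theorem natCard_repr_dihedralPrime (hσ : orderOf σ = p) (hτ : orderOf τ = 2) (hcard : Nat.card G = 2 * p) (i : Fin 4) :
    Nat.card ((![⊥, Subgroup.zpowers τ, Subgroup.zpowers σ, ⊤] : Fin 4 → Subgroup G) i) =
      (![1, 2, p, 2 * p] : Fin 4 → ℕ) i := by
  fin_cases i
  · exact Subgroup.card_bot
  · exact (Nat.card_zpowers τ).trans hτ
  · exact (Nat.card_zpowers σ).trans hσ
  · change Nat.card (⊤ : Subgroup G) = 2 * p
    rw [Subgroup.card_top, hcard]

omit [Fintype G] in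
/-- **The representatives `1, C_2, C_p, D_{2p}` are pairwise non-conjugate** (orders `1, 2, p, 2p` differ for an
odd prime `p`). [cite: DokchitserEtAl2022, §1.3 Remark 1.5] -/
theorem repr_dihedralPrime_nonconj (hσ : orderOf σ = p) (hp : p.Prime) (hp2 : p ≠ 2) (hτ : orderOf τ = 2)
    (hcard : Nat.card G = 2 * p) (i j : Fin 4) (x : G)
    (h : (![⊥, Subgroup.zpowers τ, Subgroup.zpowers σ, ⊤] : Fin 4 → Subgroup G) j =
      ((![⊥, Subgroup.zpowers τ, Subgroup.zpowers σ, ⊤] : Fin 4 → Subgroup G) i).map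
        (MulAut.conj x).toMonoidHom) : i = j := by
  have hc := congrArg (fun L : Subgroup G ↦ Nat.card L) h
  rw [Subgroup.card_map_of_injective (MulAut.conj x).injective, natCard_repr_dihedralPrime hσ hτ hcard,
    natCard_repr_dihedralPrime hσ hτ hcard] at hc
  have hp0 := hp.ne_zero
  have hp1 := hp.one_lt
  fin_cases i <;> fin_cases j <;> simp at hc ⊢ <;> omega

/-- **Every cyclic subgroup of `D_{2p}` is conjugate to `1`, `C_2` or `C_p`.** [cite: DokchitserEtAl2022, §1.3 Remark 1.5] -/
theorem repr_dihedralPrime_covers (hσ : orderOf σ = p) (hp : p.Prime) (hp2 : p ≠ 2) (hτ : orderOf τ = 2)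
    (hστ : τ * σ * τ⁻¹ = σ⁻¹) (hcard : Nat.card G = 2 * p) (z : G) :
    ∃ i : Fin 4, ∃ x : G, Subgroup.zpowers z =
      ((![⊥, Subgroup.zpowers τ, Subgroup.zpowers σ, ⊤] : Fin 4 → Subgroup G) i).map
        (MulAut.conj x).toMonoidHom := by
  have hodd : Odd p := hp.eq_two_or_odd'.resolve_left hp2
  rcases mem_zpowers_or_exists_eq_mul_of_card hσ hodd hτ hcard z with hz | ⟨a, ha, rfl⟩
  · by_cases hz1 : z = 1
    · subst hz1
      exact ⟨0, 1, by rw [Subgroup.zpowers_one_eq_bot]; exact (Subgroup.map_bot _).symm⟩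
    · refine ⟨2, 1, ?_⟩
      change Subgroup.zpowers z = (Subgroup.zpowers σ).map _
      rw [zpowers_map_mulAut_conj, one_mul, inv_one, mul_one, zpowers_eq_zpowers_of_mem hσ hp hz hz1]
  · obtain ⟨b, -, hb⟩ := exists_conj_tau_eq_reflection hσ hodd hστ ha
    refine ⟨1, b, ?_⟩
    change Subgroup.zpowers (a * τ) = (Subgroup.zpowers τ).map _
    rw [zpowers_map_mulAut_conj, hb]

variable (𝒦 : Submodule ℤ (Fin 4 → ℤ))
  (h𝒦 : ∀ a : Fin 4 → ℤ, a ∈ 𝒦 ↔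
    ∑ i, (a i : ℂ) • indClassFun ((![⊥, Subgroup.zpowers τ, Subgroup.zpowers σ, ⊤] : Fin 4 → Subgroup G) i) 1 = 0)
include h𝒦

/-- **`rank K(D_{2p}) = 1`** (`p` an odd prime; all proper subgroups are cyclic).
[cite: DokchitserEtAl2022, §1.3 Remark 1.5] [cite: BartelDokchitser2015, §2 (rank of K(G))] -/
theorem finrank_brauerRelations_dihedralPrime (hσ : orderOf σ = p) (hp : p.Prime) (hp2 : p ≠ 2) (hτ : orderOf τ = 2)
    (hστ : τ * σ * τ⁻¹ = σ⁻¹) (hcard : Nat.card G = 2 * p) : Module.finrank ℤ 𝒦 = 1 :=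
  finrank_brauerRelations_eq_one_of_card_eq_prime_mul_prime _ 𝒦 h𝒦 Nat.prime_two hp hcard
    (not_isCyclic_of_dihedralPrime hσ (hp.eq_two_or_odd'.resolve_left hp2) hp.one_lt.ne' hστ)
    (repr_dihedralPrime_covers hσ hp hp2 hτ hστ hcard) (repr_dihedralPrime_nonconj hσ hp hp2 hτ hcard) ⟨3, rfl⟩

/-- **`Θ = 2C_2 + C_p − 2D_{2p} − 1 ∈ K(D_{2p})`** (coordinates `![−1, 2, 1, −2]` on `![1, C_2, C_p, D_{2p}]`).
[cite: DokchitserEtAl2022, §1.3 Remark 1.5] [cite: BartelDokchitser2015, §2 Example 2] -/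
theorem theta_mem_brauerRelations_dihedralPrime (hσ : orderOf σ = p) (hp : p.Prime) (hp2 : p ≠ 2)
    (hτ : orderOf τ = 2) (hστ : τ * σ * τ⁻¹ = σ⁻¹) (hcard : Nat.card G = 2 * p) :
    (![-1, 2, 1, -2] : Fin 4 → ℤ) ∈ 𝒦 :=
  (h𝒦 _).2 (sum_theta_smul_indClassFun_dihedralPrime_eq_zero hσ hp hp2 hτ hστ hcard)

/-- **"The above Brauer relations are unique, up to multiplication by integers"**: every `a ∈ K(D_{2p})` is
`a_{C_p} · Θ`. [cite: DokchitserEtAl2022, §1.3 Remark 1.5] -/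
theorem eq_smul_theta_of_mem_brauerRelations_dihedralPrime (hσ : orderOf σ = p) (hp : p.Prime) (hp2 : p ≠ 2)
    (hτ : orderOf τ = 2) (hστ : τ * σ * τ⁻¹ = σ⁻¹) (hcard : Nat.card G = 2 * p) {a : Fin 4 → ℤ} (ha : a ∈ 𝒦) :
    a = a 2 • (![-1, 2, 1, -2] : Fin 4 → ℤ) :=
  eq_smul_of_mem_of_finrank_eq_one 𝒦 (finrank_brauerRelations_dihedralPrime 𝒦 h𝒦 hσ hp hp2 hτ hστ hcard)
    (theta_mem_brauerRelations_dihedralPrime 𝒦 h𝒦 hσ hp hp2 hτ hστ hcard) rfl ha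

/-- **`K(D_{2p}) = ℤ · Θ`.** [cite: DokchitserEtAl2022, §1.3 Remark 1.5] -/
theorem brauerRelations_dihedralPrime_eq_span (hσ : orderOf σ = p) (hp : p.Prime) (hp2 : p ≠ 2)
    (hτ : orderOf τ = 2) (hστ : τ * σ * τ⁻¹ = σ⁻¹) (hcard : Nat.card G = 2 * p) :
    𝒦 = Submodule.span ℤ {(![-1, 2, 1, -2] : Fin 4 → ℤ)} :=
  eq_span_singleton_of_finrank_eq_one 𝒦 (finrank_brauerRelations_dihedralPrime 𝒦 h𝒦 hσ hp hp2 hτ hστ hcard)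
    (theta_mem_brauerRelations_dihedralPrime 𝒦 h𝒦 hσ hp hp2 hτ hστ hcard) (k := 2) rfl

omit h𝒦 in
/-- The canonical lattice: `K(D_{2p}) = ker(a ↦ Σ_i a_i (1_{H_i})^G) = ℤ · Θ`. [cite: DokchitserEtAl2022, §1.3 Remark 1.5]
[cite: BartelDokchitser2015, §1.1 ("Θ ∈ K(G) ⟺ Σ_i n_i Ind 1 = 0")] -/
theorem ker_linearCombination_indClassFun_one_dihedralPrime_eq_span (hσ : orderOf σ = p) (hp : p.Prime)
    (hp2 : p ≠ 2) (hτ : orderOf τ = 2) (hστ : τ * σ * τ⁻¹ = σ⁻¹) (hcard : Nat.card G = 2 * p) :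
    LinearMap.ker (Fintype.linearCombination ℤ fun i : Fin 4 ↦
      indClassFun ((![⊥, Subgroup.zpowers τ, Subgroup.zpowers σ, ⊤] : Fin 4 → Subgroup G) i) 1) =
      Submodule.span ℤ {(![-1, 2, 1, -2] : Fin 4 → ℤ)} :=
  brauerRelations_dihedralPrime_eq_span _
    (mem_ker_linearCombination_indClassFun_one_iff
      (![⊥, Subgroup.zpowers τ, Subgroup.zpowers σ, ⊤] : Fin 4 → Subgroup G)) hσ hp hp2 hτ hστ hcard

end DihedralPrimeLattice

/-! ## §5 The model `DihedralGroup p` of Mathlib: `σ = r 1`, `τ = sr 0` -/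

section MathlibModel

open DihedralGroup

variable {p : ℕ}

/-- `(sr 0)(r 1)(sr 0)⁻¹ = (r 1)⁻¹` in `DihedralGroup p`. [cite: DokchitserEtAl2022, §1.3 Remark 1.5 (D_{2p})] -/
theorem dihedralGroup_sr_conj_r : (sr 0 : DihedralGroup p) * r 1 * (sr 0)⁻¹ = (r 1)⁻¹ := by
  simp

/-- **`2·(1_{⟨sr 0⟩})^{D_{2p}} + (1_{⟨r 1⟩})^{D_{2p}} = (1_1)^{D_{2p}} + 2·(1_{D_{2p}})^{D_{2p}}`** on Mathlib's
`DihedralGroup p`, `p` an odd prime. [cite: DokchitserEtAl2022, §1.3 Remark 1.5] -/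
theorem two_smul_indClassFun_sr_add_indClassFun_r [NeZero p] (hp : p.Prime) (hp2 : p ≠ 2) :
    (2 : ℂ) • indClassFun (Subgroup.zpowers (sr 0 : DihedralGroup p)) 1 +
        indClassFun (Subgroup.zpowers (r 1 : DihedralGroup p)) 1 =
      indClassFun (⊥ : Subgroup (DihedralGroup p)) 1 + (2 : ℂ) • indClassFun (⊤ : Subgroup (DihedralGroup p)) 1 :=
  two_smul_indClassFun_tau_add_indClassFun_sigma orderOf_r_one hp hp2 (orderOf_sr 0) dihedralGroup_sr_conj_r nat_card

/-- **`K(DihedralGroup p) = ℤ · (2C_2 + C_p − 2D_{2p} − 1)`** on the representatives `![⊥, ⟨sr 0⟩, ⟨r 1⟩, ⊤]`, for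
every lattice with the Brauer-relation membership test (`p` an odd prime). [cite: DokchitserEtAl2022, §1.3 Remark 1.5] -/
theorem brauerRelations_dihedralGroup_eq_span [NeZero p] (hp : p.Prime) (hp2 : p ≠ 2) (𝒦 : Submodule ℤ (Fin 4 → ℤ))
    (h𝒦 : ∀ a : Fin 4 → ℤ, a ∈ 𝒦 ↔
      ∑ i, (a i : ℂ) • indClassFun ((![⊥, Subgroup.zpowers (sr 0), Subgroup.zpowers (r 1), ⊤] :
        Fin 4 → Subgroup (DihedralGroup p)) i) 1 = 0) :
    𝒦 = Submodule.span ℤ {(![-1, 2, 1, -2] : Fin 4 → ℤ)} :=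
  brauerRelations_dihedralPrime_eq_span 𝒦 h𝒦 orderOf_r_one hp hp2 (orderOf_sr 0) dihedralGroup_sr_conj_r nat_card

/-- The canonical lattice of `DihedralGroup p`: `ker(a ↦ Σ_i a_i (1_{H_i})^{D_{2p}}) = ℤ · Θ`. [cite: DokchitserEtAl2022, §1.3 Remark 1.5] -/
theorem ker_linearCombination_indClassFun_one_dihedralGroup_eq_span [NeZero p] (hp : p.Prime) (hp2 : p ≠ 2) :
    LinearMap.ker (Fintype.linearCombination ℤ fun i : Fin 4 ↦
      indClassFun ((![⊥, Subgroup.zpowers (sr 0), Subgroup.zpowers (r 1), ⊤] :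
        Fin 4 → Subgroup (DihedralGroup p)) i) 1) =
      Submodule.span ℤ {(![-1, 2, 1, -2] : Fin 4 → ℤ)} :=
  ker_linearCombination_indClassFun_one_dihedralPrime_eq_span orderOf_r_one hp hp2 (orderOf_sr 0)
    dihedralGroup_sr_conj_r nat_card

end MathlibModel

end AbelianVariety

end Literature.AlgebraicGeometry.Motives
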